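import Literature.Probability.Percolation.KozmaNitzanPreFKG
import HarnessLib

/-!
# Crux `PercNearOneGluing.AdditiveGluing` (stmt-CriticalPhenomena-4576): the MULTIPLICATIVE Kozma–Nitzan Lemma 4

Support file (`--supports stmt-CriticalPhenomena-4576`, lead png-lead-4576 / rtask e8780df7).  No definitions, no named
facts, no sorries.

For a weighted graph, a target `b`, a pair `e = {a₁, a₂}` and a vertex `x` write `h(x) = μ(x ↔ b)` and
`Gain_x(e) = μ({x ↮ b} ∩ ({x ↔ a₁} ∩ {a₂ ↔ b} ∪ {x ↔ a₂} ∩ {a₁ ↔ b}))` — the probability that `x` is joined to `b` only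
after gluing `e` (so `μ_{G/e}(x ↔ b) = h(x) + Gain_x(e)`, and `Gain_{a₁}(e) = μ(a₁ ↮ b, a₂ ↔ b) =: π₁`).
Kozma–Nitzan's Lemma 4 / eq. (9) says that the ADDITIVE gain is largest at the weaker endpoint:
`Gain_x(e) ≤ max(π₁, π₂)`.  The theorem of this file is the MULTIPLICATIVE version:

  **`h(a₁) ≤ h(a₂)` ⟹ `h(a₁) · Gain_o(e) ≤ π₁ · h(o)` for EVERY vertex `o`**  (`knLemma4Mult`),

i.e. `μ_{G/e}(o↔b) / μ_G(o↔b) ≤ μ_{G/e}(a₁↔b) / μ_G(a₁↔b)`: the relative boost from gluing `e` is maximal at the weaker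
endpoint of `e`.  It is sharper than Lemma 4 exactly for observers `o` below `a₁` (`h(o) ≤ h(a₁)`), which is the case the
gluing flow for the crux needs (the single-pair raise at the unique minimiser is then monotone for the MULTIPLICATIVE
potential `log h(o) − log min_A h − log μ(o ↔ A)` of Conjecture 1, not only for the additive margin); equality holds when
`a₁` separates `o` from `{a₂, b}` (pendant observers).
Proof ("BHK four times", the pattern of Kozma–Nitzan's Theorem 1, plus Harris twice): with `D = {a₁ ↮ a₂}`,
`d = μ(D)`, `Aᵢ = μ(D ∩ {o↔aᵢ})`, `π₁ = μ(D ∩ {a₂↔b})`, `π₂ = μ(D ∩ {a₁↔b})`, `c = μ(a₁↔b ∩ a₂↔b)`: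
`d·Gain_o ≤ A₁π₁ + A₂π₂` (BHK Thm 1.4 twice), `d·h(o) ≥ A₁π₂ + A₂π₁ + (A₁+A₂)c` (BHK Thm 1.3 twice, Harris twice), and
`π₁(A₁π₂ + A₂π₁ + (A₁+A₂)c) − (π₂+c)(A₁π₁ + A₂π₂) = A₂(π₁−π₂)(π₁+π₂+c) ≥ 0` because `h(a₁) ≤ h(a₂)` iff `π₂ ≤ π₁`.
[cite: KozmaNitzan2024, Lemma 4 / eq. (9) (pp. 9–10), Theorem 1 (pp. 7–8); VandenbergHaggstromKahn2005, Thms. 1.3–1.5 (pp. 6–7)]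
-/

namespace Summit.CriticalPhenomena.PercolationContinuityZ3.Theorems

open MeasureTheory Set Literature.Probability.LatticeModels Literature.Probability.Percolation
open Literature.Probability.Percolation.KNPreFKG

noncomputable section
open Classical

variable {V : Type*} [Fintype V]

/-- **Multiplicative Kozma–Nitzan Lemma 4.**  If `h(a₁) ≤ h(a₂)` then for every vertex `o`:
`h(a₁) · μ({o↮b} ∩ ({o↔a₁}∩{a₂↔b} ∪ {o↔a₂}∩{a₁↔b})) ≤ μ({a₁↮b} ∩ {a₂↔b}) · h(o)` — the relative gain from gluing
`{a₁, a₂}` is largest at the weaker endpoint.  Not in print; proved here by BHK Thms 1.3/1.4 (four times) and Harris (twice).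
[cite: KozmaNitzan2024, Lemma 4 / eq. (9) (pp. 9–10); VandenbergHaggstromKahn2005, Thm. 1.3 (p. 6), Thm. 1.4 (p. 7)] -/
theorem knLemma4Mult (w : Sym2 V → unitInterval) (o b a₁ a₂ : V)
    (h12 : (prodBernoulli w).real (openConn a₁ b) ≤ (prodBernoulli w).real (openConn a₂ b)) :
    (prodBernoulli w).real (openConn a₁ b) *
        (prodBernoulli w).real ((openConn o b)ᶜ ∩ (openConn o a₁ ∩ openConn a₂ b ∪ openConn o a₂ ∩ openConn a₁ b)) ≤
      (prodBernoulli w).real ((openConn a₁ b)ᶜ ∩ openConn a₂ b) * (prodBernoulli w).real (openConn o b) := by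
  set μ := prodBernoulli w with hμ
  have hm : ∀ s : Set (BondConfig V), MeasurableSet s := fun _ => MeasurableSet.of_discrete
  have hsplit : ∀ A S : Set (BondConfig V), μ.real A = μ.real (A ∩ S) + μ.real (A ∩ Sᶜ) := by
    intro A S
    rw [← measureReal_inter_add_sdiff (s := A) (hm S), Set.sdiff_eq]
  by_cases h12eq : a₁ = a₂
  · -- degenerate pair: the gain event forces `o ↔ b`, so it is empty
    subst h12eq
    have hG : ((openConn o b)ᶜ ∩ (openConn o a₁ ∩ openConn a₁ b ∪ openConn o a₁ ∩ openConn a₁ b) :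
        Set (BondConfig V)) = ∅ := by
      ext ω
      simp only [mem_inter_iff, mem_compl_iff, mem_union, openConn, mem_setOf_eq, mem_empty_iff_false, iff_false,
        not_and]
      intro hob h
      rcases h with ⟨h1, hb⟩ | ⟨h1, hb⟩ <;> exact hob (h1.trans hb)
    rw [hG, measureReal_empty, mul_zero]
    exact mul_nonneg measureReal_nonneg measureReal_nonneg
  set O₁ : Set (BondConfig V) := openConn o a₁ with hO₁
  set O₂ : Set (BondConfig V) := openConn o a₂ with hO₂
  set Ob : Set (BondConfig V) := openConn o b with hOb
  set B₁ : Set (BondConfig V) := openConn a₁ b with hB₁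
  set B₂ : Set (BondConfig V) := openConn a₂ b with hB₂
  set D : Set (BondConfig V) := {ω | ¬ (openGraph ω).Reachable a₁ a₂} with hD
  -- the gain event splits along `D` into the two crossed two-cluster events
  have hGain : (Obᶜ ∩ (O₁ ∩ B₂ ∪ O₂ ∩ B₁)) = (O₁ ∩ B₂ ∩ D) ∪ (O₂ ∩ B₁ ∩ D) := by
    ext ω
    simp only [mem_inter_iff, mem_compl_iff, mem_union, hO₁, hO₂, hOb, hB₁, hB₂, hD, openConn, mem_setOf_eq]
    constructor
    · rintro ⟨hob, ⟨h1, hb2⟩ | ⟨h2, hb1⟩⟩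
      · exact Or.inl ⟨⟨h1, hb2⟩, fun h => hob ((h1.trans h).trans hb2)⟩
      · exact Or.inr ⟨⟨h2, hb1⟩, fun h => hob ((h2.trans h.symm).trans hb1)⟩
    · rintro (⟨⟨h1, hb2⟩, hn⟩ | ⟨⟨h2, hb1⟩, hn⟩)
      · exact ⟨fun hob => hn ((h1.symm.trans hob).trans hb2.symm), Or.inl ⟨h1, hb2⟩⟩
      · exact ⟨fun hob => hn ((hb1.trans hob.symm).trans h2), Or.inr ⟨h2, hb1⟩⟩
  have hdisj : Disjoint (O₁ ∩ B₂ ∩ D) (O₂ ∩ B₁ ∩ D) := by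
    rw [Set.disjoint_left]
    rintro ω ⟨⟨h1, _⟩, hn⟩ ⟨⟨h2, _⟩, _⟩
    exact hn (h1.symm.trans h2)
  have hGain_eq : μ.real (Obᶜ ∩ (O₁ ∩ B₂ ∪ O₂ ∩ B₁)) = μ.real (O₁ ∩ B₂ ∩ D) + μ.real (O₂ ∩ B₁ ∩ D) := by
    rw [hGain, measureReal_union hdisj (hm _)]
  -- `π₁ = μ(B₁ᶜ ∩ B₂) = μ(D ∩ B₂)`, `π₂ = μ(D ∩ B₁)`, `θ₁ = π₂ + c`, `θ₂ = π₁ + c`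
  have hpi1 : (B₁ᶜ ∩ B₂) = D ∩ B₂ := by
    ext ω
    simp only [mem_inter_iff, mem_compl_iff, hB₁, hB₂, hD, openConn, mem_setOf_eq]
    constructor
    · rintro ⟨hn1, hb2⟩
      exact ⟨fun h => hn1 (h.trans hb2), hb2⟩
    · rintro ⟨hn, hb2⟩
      exact ⟨fun hb1 => hn (hb1.trans hb2.symm), hb2⟩
  have hpi2 : (B₁ ∩ B₂ᶜ) = D ∩ B₁ := by
    ext ω
    simp only [mem_inter_iff, mem_compl_iff, hB₁, hB₂, hD, openConn, mem_setOf_eq]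
    constructor
    · rintro ⟨hb1, hn2⟩
      exact ⟨fun h => hn2 (h.symm.trans hb1), hb1⟩
    · rintro ⟨hn, hb1⟩
      exact ⟨hb1, fun hb2 => hn (hb1.trans hb2.symm)⟩
  have hθ1 : μ.real B₁ = μ.real (D ∩ B₁) + μ.real (B₁ ∩ B₂) := by
    rw [hsplit B₁ B₂, hpi2]; ring
  have hθ2 : μ.real B₂ = μ.real (D ∩ B₂) + μ.real (B₁ ∩ B₂) := by
    rw [hsplit B₂ B₁, show B₂ ∩ B₁ = B₁ ∩ B₂ from inter_comm _ _, show B₂ ∩ B₁ᶜ = B₁ᶜ ∩ B₂ from inter_comm _ _, hpi1]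
    ring
  have hπ : μ.real (D ∩ B₁) ≤ μ.real (D ∩ B₂) := by linarith
  -- three disjoint pieces of `{o ↔ b}`
  have hS1 : O₁ ∩ B₁ ∩ D ⊆ Ob := by
    rintro ω ⟨⟨h1, hb⟩, _⟩; exact h1.trans hb
  have hS2 : O₂ ∩ B₂ ∩ D ⊆ Ob := by
    rintro ω ⟨⟨h2, hb⟩, _⟩; exact h2.trans hb
  have hS3 : (O₁ ∪ O₂) ∩ (B₁ ∩ B₂) ⊆ Ob := by
    rintro ω ⟨h1 | h2, ⟨hb1, hb2⟩⟩
    · exact h1.trans hb1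
    · exact h2.trans hb2
  have hOb_ge : μ.real (O₁ ∩ B₁ ∩ D) + μ.real (O₂ ∩ B₂ ∩ D) + μ.real ((O₁ ∪ O₂) ∩ (B₁ ∩ B₂)) ≤ μ.real Ob := by
    have hd12 : Disjoint (O₁ ∩ B₁ ∩ D) (O₂ ∩ B₂ ∩ D) := by
      rw [Set.disjoint_left]
      rintro ω ⟨⟨h1, _⟩, hn⟩ ⟨⟨h2, _⟩, _⟩
      exact hn (h1.symm.trans h2)
    have hd3 : Disjoint (O₁ ∩ B₁ ∩ D ∪ O₂ ∩ B₂ ∩ D) ((O₁ ∪ O₂) ∩ (B₁ ∩ B₂)) := by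
      rw [Set.disjoint_left]
      rintro ω hω ⟨_, ⟨hb1, hb2⟩⟩
      rcases hω with ⟨_, hn⟩ | ⟨_, hn⟩ <;> exact hn (hb1.trans hb2.symm)
    rw [← measureReal_union hd12 (hm _), ← measureReal_union hd3 (hm _)]
    exact measureReal_mono (union_subset (union_subset hS1 hS2) hS3)
  -- Harris twice: `μ((O₁∪O₂) ∩ (B₁∩B₂)) ≥ μ(O₁∪O₂) μ(B₁∩B₂)` and `μ((O₁∪O₂) ∩ D) ≤ μ(O₁∪O₂) μ(D)`
  have hupO : IsUpperSet (O₁ ∪ O₂) := (isUpperSet_openConn o a₁).union (isUpperSet_openConn o a₂)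
  have hupB : IsUpperSet (B₁ ∩ B₂) := (isUpperSet_openConn a₁ b).inter (isUpperSet_openConn a₂ b)
  have hloD : IsLowerSet D := by
    intro ω ω' hle hω h
    exact hω (h.mono (openGraph_mono hle))
  have hH1 : μ.real (O₁ ∪ O₂) * μ.real (B₁ ∩ B₂) ≤ μ.real ((O₁ ∪ O₂) ∩ (B₁ ∩ B₂)) :=
    prodBernoulli_harris w hupO hupB (hm _) (hm _)
  have hH2 : μ.real ((O₁ ∪ O₂) ∩ D) ≤ μ.real (O₁ ∪ O₂) * μ.real D :=
    prodBernoulli_harris_upper_lower w hupO hloD (hm _) (hm _)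
  have hOD : μ.real ((O₁ ∪ O₂) ∩ D) = μ.real (D ∩ O₁) + μ.real (D ∩ O₂) := by
    have hd : Disjoint (D ∩ O₁) (D ∩ O₂) := by
      rw [Set.disjoint_left]
      rintro ω ⟨hn, h1⟩ ⟨_, h2⟩
      exact hn (h1.symm.trans h2)
    rw [← measureReal_union hd (hm _)]
    congr 1
    ext ω
    simp only [mem_inter_iff, mem_union]
    tauto
  -- BHK four times, given `D = {a₁ ↮ a₂}` (as in `KNPreFKG.preFKG_pair`)
  have hD1 : {ω : BondConfig V | ∀ x ∈ ({a₂} : Set V), ¬ (openGraph ω).Reachable a₁ x} = D := by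
    ext ω
    simp [hD]
  have hD2 : {ω : BondConfig V | ∀ x ∈ ({a₁} : Set V), ¬ (openGraph ω).Reachable a₂ x} = D := by
    ext ω
    simp only [mem_setOf_eq, mem_singleton_iff, forall_eq, hD]
    exact not_congr ⟨SimpleGraph.Reachable.symm, SimpleGraph.Reachable.symm⟩
  have hD3 : {ω : BondConfig V | ¬ (openGraph ω).Reachable a₂ a₁} = D := by
    ext ω
    simp only [mem_setOf_eq, hD]
    exact not_congr ⟨SimpleGraph.Reachable.symm, SimpleGraph.Reachable.symm⟩
  -- (i) `μ(D ∩ O₂) μ(D ∩ B₂) ≤ μ(D) μ(O₂ ∩ B₂ ∩ D)`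
  have h_i := bhk_one_upper_upper w a₂ ({a₁} : Set V) (by simpa using Ne.symm h12eq)
    (isUpperSet_connFamily a₂ o) (isUpperSet_connFamily a₂ b)
  rw [hD2, ← openConn_eq_setOf_connFamily, ← openConn_eq_setOf_connFamily, openConn_symm a₂ o] at h_i
  -- (ii) `μ(D) μ(O₂ ∩ B₁ ∩ D) ≤ μ(D ∩ O₂) μ(D ∩ B₁)`
  have h_ii := bhk_two_upper_upper w a₂ a₁ (Ne.symm h12eq) (isUpperSet_connFamily a₂ o)
    (isUpperSet_connFamily a₁ b)
  rw [hD3, ← openConn_eq_setOf_connFamily, ← openConn_eq_setOf_connFamily, openConn_symm a₂ o] at h_ii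
  -- (iii) `μ(D ∩ O₁) μ(D ∩ B₁) ≤ μ(D) μ(O₁ ∩ B₁ ∩ D)`
  have h_iii := bhk_one_upper_upper w a₁ ({a₂} : Set V) (by simpa using h12eq)
    (isUpperSet_connFamily a₁ o) (isUpperSet_connFamily a₁ b)
  rw [hD1, ← openConn_eq_setOf_connFamily, ← openConn_eq_setOf_connFamily, openConn_symm a₁ o] at h_iii
  -- (iv) `μ(D) μ(O₁ ∩ B₂ ∩ D) ≤ μ(D ∩ O₁) μ(D ∩ B₂)`
  have h_iv := bhk_two_upper_upper w a₁ a₂ h12eq (isUpperSet_connFamily a₁ o)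
    (isUpperSet_connFamily a₂ b)
  rw [← openConn_eq_setOf_connFamily, ← openConn_eq_setOf_connFamily, openConn_symm a₁ o] at h_iv
  have e1 : D ∩ (O₂ ∩ B₂) = O₂ ∩ B₂ ∩ D := inter_comm _ _
  have e2 : D ∩ (O₂ ∩ B₁) = O₂ ∩ B₁ ∩ D := inter_comm _ _
  have e3 : D ∩ (O₁ ∩ B₁) = O₁ ∩ B₁ ∩ D := inter_comm _ _
  have e4 : D ∩ (O₁ ∩ B₂) = O₁ ∩ B₂ ∩ D := inter_comm _ _
  simp only [← hD, ← hO₁, ← hO₂, ← hB₁, ← hB₂] at h_i h_ii h_iii h_iv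
  rw [e1] at h_i
  rw [e2] at h_ii
  rw [e3] at h_iii
  rw [e4] at h_iv
  -- combine
  rw [hGain_eq, hpi1]
  by_cases hD0 : μ.real D = 0
  · have hz : ∀ A : Set (BondConfig V), μ.real (A ∩ D) = 0 := fun A =>
      le_antisymm ((measureReal_mono inter_subset_right).trans hD0.le) measureReal_nonneg
    rw [hz, hz, add_zero, mul_zero]
    exact mul_nonneg measureReal_nonneg measureReal_nonneg
  · have hDpos : 0 < μ.real D := lt_of_le_of_ne measureReal_nonneg (Ne.symm hD0)
    -- everything multiplied by `d = μ(D) > 0`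
    have hA1 : 0 ≤ μ.real (D ∩ O₁) := measureReal_nonneg
    have hA2 : 0 ≤ μ.real (D ∩ O₂) := measureReal_nonneg
    have hc : 0 ≤ μ.real (B₁ ∩ B₂) := measureReal_nonneg
    have hp1 : 0 ≤ μ.real (D ∩ B₂) := measureReal_nonneg
    have hp2 : 0 ≤ μ.real (D ∩ B₁) := measureReal_nonneg
    have hOu : 0 ≤ μ.real (O₁ ∪ O₂) := measureReal_nonneg
    -- `d · Gain ≤ A₁ π₁ + A₂ π₂`
    have hgain : μ.real D * (μ.real (O₁ ∩ B₂ ∩ D) + μ.real (O₂ ∩ B₁ ∩ D)) ≤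
        μ.real (D ∩ O₁) * μ.real (D ∩ B₂) + μ.real (D ∩ O₂) * μ.real (D ∩ B₁) := by
      nlinarith [h_iv, h_ii]
    -- `d · h(o) ≥ A₁ π₂ + A₂ π₁ + (A₁ + A₂) c`
    have hob : μ.real (D ∩ O₁) * μ.real (D ∩ B₁) + μ.real (D ∩ O₂) * μ.real (D ∩ B₂) +
        (μ.real (D ∩ O₁) + μ.real (D ∩ O₂)) * μ.real (B₁ ∩ B₂) ≤ μ.real D * μ.real Ob := by
      have h3 : (μ.real (D ∩ O₁) + μ.real (D ∩ O₂)) * μ.real (B₁ ∩ B₂) ≤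
          μ.real D * μ.real ((O₁ ∪ O₂) ∩ (B₁ ∩ B₂)) := by
        rw [← hOD]
        calc μ.real ((O₁ ∪ O₂) ∩ D) * μ.real (B₁ ∩ B₂)
            ≤ μ.real (O₁ ∪ O₂) * μ.real D * μ.real (B₁ ∩ B₂) := by
              exact mul_le_mul_of_nonneg_right hH2 hc
          _ = μ.real D * (μ.real (O₁ ∪ O₂) * μ.real (B₁ ∩ B₂)) := by ring
          _ ≤ μ.real D * μ.real ((O₁ ∪ O₂) ∩ (B₁ ∩ B₂)) := mul_le_mul_of_nonneg_left hH1 hDpos.le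
      nlinarith [h_iii, h_i, h3, mul_le_mul_of_nonneg_left hOb_ge hDpos.le]
    -- final algebra: `π₁ (A₁π₂ + A₂π₁ + (A₁+A₂)c) − (π₂ + c)(A₁π₁ + A₂π₂) = A₂ (π₁ − π₂)(π₁ + π₂ + c) ≥ 0`
    have key : μ.real D * (μ.real B₁ * (μ.real (O₁ ∩ B₂ ∩ D) + μ.real (O₂ ∩ B₁ ∩ D))) ≤
        μ.real D * (μ.real (D ∩ B₂) * μ.real Ob) := by
      rw [hθ1]
      have hfin : 0 ≤ μ.real (D ∩ O₂) * (μ.real (D ∩ B₂) - μ.real (D ∩ B₁)) *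
          (μ.real (D ∩ B₂) + μ.real (D ∩ B₁) + μ.real (B₁ ∩ B₂)) :=
        mul_nonneg (mul_nonneg hA2 (by linarith)) (by linarith)
      nlinarith [hgain, hob, hfin, mul_le_mul_of_nonneg_left hgain (add_nonneg hp2 hc),
        mul_le_mul_of_nonneg_left hob hp1]
    exact le_of_mul_le_mul_left key hDpos

end

end Summit.CriticalPhenomena.PercolationContinuityZ3.Theorems
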